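import Summits.ResolutionOfSingularities.ResolutionOfSingularities.Theorems.RadicialJungCleanModelsStubCossartPiltant2019OfNamedInvariantCofinality
import Summits.ResolutionOfSingularities.ResolutionOfSingularities.Theorems.RadicialJungCleanModelsStubCossartPiltant2019OfNamedPushDown
import HarnessLib

/-!
# `CleanModels`, stub 2 (F-02): `InvariantCofinality3 ⟹ CossartPiltant2008_lemma94_kummerCore` — the named candidate statement of OURS
# implies the printed tame push-down ([CoP1] Lemma 9.4, totally ramified Kummer core)

OURS (decomp-res hand-1 g20; crux `stmt-ResolutionOfSingularities-15917`, stub 2 of `Cruxes/CleanModels/Lines/Sketch.lean` rev 35).  A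
BOOKKEEPING file relating the two kinds of named leaves landed this generation: the `@[conjecture]` printed statement
`CossartPiltant2008_lemma94_kummerCore` (`…OfNamedPushDown.lean`) and the `@[conjecture]` candidate statement of OURS `InvariantCofinality3`
(`…OfNamedInvariantCofinality.lean`).

* `stableLocalRing_kummer_of_invariantCofinality` — in a totally ramified Kummer step `A(θ) | A` of prime degree with inertia group `⊤`,
  invariant cofinality (the binder `hICof`, verbatim the body of `InvariantCofinality3` at universe `0`) turns a local uniformization of
  `A(θ)` into one whose local ring is stable under `Gal(A(θ) | A)` — the conclusion of the tree's `hStabLoc` — by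
  `exists_stableLU_of_invariantCofinality` applied to the group of `S`-automorphisms of `E` restricting to `Gal(A(θ) | A)` (every element
  of `Gal(A(θ) | A)` extends to `E`, `E | A` being normal);
* `lemma94KummerCore_of_invariantCofinality3 : InvariantCofinality3.{0} → CossartPiltant2008_lemma94_kummerCore.{0}` — through the tree's
  `kummerCore_of_stableLocalRing` ([CoP1] Lemma 9.4's invariants-and-lattice argument, typed).

So the printed tame push-down is a CONSEQUENCE of invariant cofinality; together with `cossartPiltant2019_of_stub1_of_invariantCofinality3_of_hironaka`
this makes `InvariantCofinality3` the single research target below CP 2019 Thm. 1.5 and CJS 2020 Thm. 1.4 for stub 2.  Nothing here proves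
resolution of singularities in positive characteristic, local uniformization in dimension three, or any statement of a manuscript under
adjudication; rung 0. AI-written; AI review weaker than expert review.
-/

-- `Summit.<Summit>.<Sub>.Theorems` with `Sub = Summit` (single-conjunct summit, D-0017)
set_option linter.dupNamespace false

noncomputable section

open IsLocalRing Polynomial AlgebraicGeometry
open _root_.IntermediateField
open Literature.AlgebraicGeometry.Resolution
open Summit.ResolutionOfSingularities.ResolutionOfSingularities.Theorems.RadicialJung.CleanModels.StabilityCriterion

namespace Summit.ResolutionOfSingularities.ResolutionOfSingularities.Theorems.RadicialJung.CleanModels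

section Tools

variable {S E : Type} [CommRing S] [Field E] [Algebra S E]

/-- If `E` is algebraic over `S`, it is algebraic over every subfield `M ∋ S` (copy of the private tool of
`ArithmeticalThreefoldsLocalDescentEquivariantSplit.lean`). [folklore] -/
private theorem isAlgebraic_subfield_of_isAlgebraic'' [Algebra.IsAlgebraic S E]
    (hinj : Function.Injective (algebraMap S E)) (M : Subfield E)
    (hSM : ∀ s : S, algebraMap S E s ∈ M) : Algebra.IsAlgebraic M E := by
  refine ⟨fun e => ?_⟩
  obtain ⟨q, hq0, hqe⟩ := Algebra.IsAlgebraic.isAlgebraic (R := S) e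
  let f : S →+* M := (algebraMap S E).codRestrict M hSM
  have hf : Function.Injective f := by
    intro a b hab
    apply hinj
    have h := congrArg (fun z : M => (z : E)) hab
    exact h
  have hcomp : (algebraMap M E).comp f = algebraMap S E := RingHom.ext fun _ => rfl
  refine ⟨q.map f, (Polynomial.map_ne_zero_iff hf).mpr hq0, ?_⟩
  rw [Polynomial.aeval_def, Polynomial.eval₂_map, hcomp]
  rwa [Polynomial.aeval_def] at hqe

/-- **Automorphisms of subextensions extend to the ambient algebraically closed field** (copy of the private tool of
`ArithmeticalThreefoldsLocalDescentEquivariantSplit.lean`): for a subfield `M ∋ S` of `E` (algebraically closed, algebraic over `S`), an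
intermediate field `N | M` and `τ ∈ Aut_M(N)`, some `S`-automorphism `σ` of `E` restricts to `τ` on `N`. [folklore] -/
private theorem exists_algEquiv_extends_of_isAlgClosed'' [IsAlgClosed E] [Algebra.IsAlgebraic S E]
    (hinj : Function.Injective (algebraMap S E)) (M : Subfield E)
    (hSM : ∀ s : S, algebraMap S E s ∈ M) (N : IntermediateField M E) (τ : N ≃ₐ[M] N) :
    ∃ σ : E ≃ₐ[S] E, ∀ x : N, σ (x : E) = ((τ x : N) : E) := by
  haveI : Algebra.IsAlgebraic M E := isAlgebraic_subfield_of_isAlgebraic'' hinj M hSM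
  haveI : IsAlgClosure M E :=
    { isAlgClosed := ‹IsAlgClosed E›, isAlgebraic := ‹Algebra.IsAlgebraic M E› }
  haveI : Normal M E := IsAlgClosure.normal M E
  let σ₀ : E ≃ₐ[M] E := τ.liftNormal E
  have hσ₀S : ∀ s : S, σ₀.toRingEquiv (algebraMap S E s) = algebraMap S E s := fun s =>
    σ₀.commutes (⟨algebraMap S E s, hSM s⟩ : M)
  refine ⟨AlgEquiv.ofRingEquiv hσ₀S, fun x => ?_⟩
  exact AlgEquiv.liftNormal_commutes τ E x

end Tools

/-- **A `Gal(A(θ) | A)`-stable local uniformization of a Kummer step from invariant cofinality** (the conclusion of the tree's `hStabLoc`,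
[CoP1] Lemma 9.4 «S is stable by G», produced rather than asserted).  Frame of the climb; `N = A(θ)` with inertia group `⊤` (so every
`τ ∈ Gal(N | A)` maps `O_E ∩ N` onto itself); `hICof` = invariant cofinality for all `(M′, H)` of the frame (the body of `InvariantCofinality3`);
a local uniformization of `N` is given.  Proof: `exists_stableLU_of_invariantCofinality` for `M′ = N` and `H` = the `S`-automorphisms of `E`
restricting to an element of `Gal(N | A)`; then every `τ` extends to some `σ ∈ H`. [folklore]
[cite: CossartPiltant2008, proof of Lemma 9.4 (HAL hal-00139124 p. 29), "S is stable by G"] -/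
theorem stableLocalRing_kummer_of_invariantCofinality (hICof : InvariantCofinality3.{0})
    (p : ℕ) (hp : p.Prime) (S : Type) [CommRing S] [IsDomain S] [IsRegularLocalRing S]
    (hS : IsExcellentRing S) (hSdim : ringKrullDim S = 3) (hSchar : CharP (ResidueField S) p)
    (hScomp : IsAdicComplete (maximalIdeal S) S)
    (E : Type) [Field E] [Algebra S E] (hinj : Function.Injective (algebraMap S E))
    (hE : IsAlgClosed E) (halg : Algebra.IsAlgebraic S E)
    (OE : ValuationSubring E) (hSO : ∀ s : S, algebraMap S E s ∈ OE)
    (hdom : ∀ s ∈ maximalIdeal S, OE.valuation (algebraMap S E s) < 1)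
    (hres : ∀ y : OE, ∃ q : S[X], (∃ i, q.coeff i ∉ maximalIdeal S) ∧
      OE.valuation (q.eval₂ (algebraMap S E) y) < 1)
    (hrk : Nonempty OE.valuation.RankOne)
    (A : Subfield E) (hSA : ∀ s : S, algebraMap S E s ∈ A) (θ : E)
    (hinert : inertiaGroupIn OE (adjoin A ({θ} : Set E)) = ⊤)
    (hLU : ∃ t : Finset E, (t : Set E) ⊆ (adjoin A ({θ} : Set E)).toSubfield ∧
      (adjoin A ({θ} : Set E)).toSubfield ≤
        Subfield.closure (Set.range (algebraMap S E) ∪ (t : Set E)) ∧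
      ∃ hTO : (Algebra.adjoin S (t : Set E)).toSubring ≤ OE.toSubring,
        IsRegularLocalRing (Localization.AtPrime
          (Ideal.comap (Subring.inclusion hTO) (maximalIdeal OE)))) :
    ∃ t : Finset E, (t : Set E) ⊆ (adjoin A ({θ} : Set E)).toSubfield ∧
      (adjoin A ({θ} : Set E)).toSubfield ≤
        Subfield.closure (Set.range (algebraMap S E) ∪ (t : Set E)) ∧
      ∃ hTO : (Algebra.adjoin S (t : Set E)).toSubring ≤ OE.toSubring,
        IsRegularLocalRing (Localization.AtPrime
          (Ideal.comap (Subring.inclusion hTO) (maximalIdeal OE))) ∧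
        ∀ (τ : adjoin A ({θ} : Set E) ≃ₐ[A] adjoin A ({θ} : Set E)) (x : adjoin A ({θ} : Set E)),
          (x : E) ∈ locAtCentre (Algebra.adjoin S (t : Set E)).toSubring OE →
          ((τ x : adjoin A ({θ} : Set E)) : E) ∈
            locAtCentre (Algebra.adjoin S (t : Set E)).toSubring OE := by
  classical
  haveI := hE
  haveI := halg
  set K₀ : IntermediateField A E := adjoin A ({θ} : Set E) with hK₀def
  have hSK : ∀ s : S, algebraMap S E s ∈ K₀.toSubfield := fun s =>
    K₀.algebraMap_mem (⟨algebraMap S E s, hSA s⟩ : A)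
  -- the group of `S`-automorphisms of `E` restricting to `Gal(A(θ)|A)`
  let H : Subgroup (E ≃ₐ[S] E) :=
    { carrier := {σ | ∃ τ : K₀ ≃ₐ[A] K₀, ∀ x : K₀, σ (x : E) = ((τ x : K₀) : E)}
      one_mem' := ⟨1, fun x => rfl⟩
      mul_mem' := by
        rintro σ₁ σ₂ ⟨τ₁, h₁⟩ ⟨τ₂, h₂⟩
        refine ⟨τ₁ * τ₂, fun x => ?_⟩
        rw [AlgEquiv.mul_apply, AlgEquiv.mul_apply, h₂ x, h₁ (τ₂ x)]
      inv_mem' := by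
        rintro σ ⟨τ, h⟩
        refine ⟨τ⁻¹, fun x => ?_⟩
        rw [AlgEquiv.aut_inv, AlgEquiv.aut_inv, AlgEquiv.symm_apply_eq, h (τ.symm x),
          AlgEquiv.apply_symm_apply] }
  have hH1 : ∀ σ ∈ H, ∀ x ∈ K₀.toSubfield, σ x ∈ K₀.toSubfield := by
    rintro σ ⟨τ, hτ⟩ x hx
    rw [hτ ⟨x, hx⟩]
    exact (τ ⟨x, hx⟩).2
  have hH2 : ∀ σ ∈ H, ∀ x ∈ K₀.toSubfield, x ∈ OE → σ x ∈ OE := by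
    rintro σ ⟨τ, hτ⟩ x hx hxO
    have hτi : τ ∈ inertiaGroupIn OE K₀ := by rw [hinert]; exact Subgroup.mem_top τ
    rw [hτ ⟨x, hx⟩]
    exact (((mem_inertiaGroupIn_iff OE K₀ τ).mp hτi).1 ⟨x, hx⟩).mp hxO
  obtain ⟨t, htK, hKle, hTO, hreg, hstab, -⟩ :=
    exists_stableLU_of_invariantCofinality (S := S) (E := E) hinj OE K₀.toSubfield hSK H hH1 hH2 hLU ∅
      (by simp) (by simp)
      (hICof p hp S hS hSdim hSchar hScomp E hinj hE halg OE hSO hdom hres hrk K₀.toSubfield hSK H hH1 hH2)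
  refine ⟨t, htK, hKle, hTO, hreg, fun τ x hx => ?_⟩
  obtain ⟨σ, hσ⟩ := exists_algEquiv_extends_of_isAlgClosed'' hinj A hSA K₀ τ
  have hσH : σ ∈ H := ⟨τ, hσ⟩
  rw [← hσ x]
  exact hstab σ hσH _ hx

/-- **`InvariantCofinality3 ⟹ CossartPiltant2008_lemma94_kummerCore`**: the candidate statement of OURS implies the printed tame
push-down ([CoP1] Lemma 9.4 in its totally ramified Kummer case), through `stableLocalRing_kummer_of_invariantCofinality` and the tree's
`kummerCore_of_stableLocalRing` (invariants `Sᴳ`, the lattice (53)–(54), `Ŝ₁ᴳ` regular — the typed remainder of the printed proof).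
[cite: CossartPiltant2008, Lemma 9.4 and its proof (HAL hal-00139124 pp. 28–29)] [cite: CossartPiltant2019, proof of Prop. 4.10 (arXiv v1 Prop. 4.8, p. 54)] -/
theorem lemma94KummerCore_of_invariantCofinality3 (hICof : InvariantCofinality3.{0}) :
    CossartPiltant2008_lemma94_kummerCore.{0} := by
  intro p hp S _ _ _ hS hSdim hSchar hScomp E _ _ hinj hE halg OE hSO hdom hres hrk ℓ hℓ hℓp ζ hζ A hSA
    hζA θ _hθA _hθℓ _hvθ hfin hgal hinert hLU
  haveI := hE
  haveI := halg
  haveI : IsGalois A (adjoin A ({θ} : Set E)) := hgal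
  exact kummerCore_of_stableLocalRing p hp hSchar hS.isUniversallyCatenaryRing hinj OE hSO hdom hres hℓ hℓp
    hζ A hSA hζA θ hfin hinert
    (stableLocalRing_kummer_of_invariantCofinality hICof p hp S hS hSdim hSchar hScomp E hinj hE halg OE hSO
      hdom hres hrk A hSA θ hinert hLU)

end Summit.ResolutionOfSingularities.ResolutionOfSingularities.Theorems.RadicialJung.CleanModels

end
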